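import Summits.HodgeConjecture.CorCM.Census.QuaternionColumnBlockCount
import Summits.HodgeConjecture.CorCM.Census.CyclicCharacterFibreLaw

/-!
# The quaternion column at ODD level: `φ₂(Q_{4n}, c) + 1 = β(Q_{4n}, c)` for every odd `n`, and the fibre law of the WHOLE column

COR-CM (cell `pub-hodgecm2`), count-neutral kernel combinatorics by the binder seat b09 (gen 41; lane CYCLIC-CHARACTER FIBRE LAW, part III), on top of
parts I–II (`Census/CyclicCharacterFibre{,Law}.lean`: the law `φ₂ + 2 = β + d` for a cyclic character `w : G → ℤ/2ᵏ` non-zero on `c`), gen 40ʼs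
`Census/QuaternionColumnBlockCount.lean` (`c_mem_zpowers_iff_even_orderOf`) and `Census/QuaternionColumnEvenFibre.lean` (`fibreTwo_eq_card_block`: `φ₂ = β` for
even `n`), all BY NAME.  Theorems only (no definition, no `decide` beyond closed identities over `ℤ/2` and `ℤ/4`, no certificate, no named fact, no `sorry`).
HONEST FRAMING: `HC_CM` is NOT proved, here or anywhere in the tree; nothing here is a period or a headline.

* §1 **THE CYCLIC CHARACTER OF `Q_{4n}`, `n` ODD** (`exists_cyclicCharacter_of_odd`): `w(a i) = 2·(i mod 2)`, `w(xa j) = 2·(j mod 2) + 1` is an additive map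
  `Q_{4n} → ℤ/4` with `w(xa 0) = 1` and `w(c) = 2 ≠ 0` (it is the quotient map `Q_{4n} ↠ Q_{4n}/⟨a²⟩ ≅ ℤ/4`, `n` odd); its odd elements are the `xa j`,
  of order `4`, hence roots of `c` — so `d = 1`.
* §2 **`φ₂(Q_{4n}, c) + 1 = β(Q_{4n}, c)` for every odd `n`** (`fibreTwo_add_one_eq_card_block_odd`, part IIʼs law) — seat b23ʼs dicyclic stabiliser row
  (`Census/DicyclicTwistStabiliser.lean`, `d₂ = 1` along a dicyclic datum) in the `QuaternionGroup n` currency of this column; with gen 40ʼs even case the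
  FIBRE LAW OF THE WHOLE QUATERNION COLUMN: **`φ₂(Q_{4n}, c) + [n odd] = β(Q_{4n}, c)`** for every `n ≥ 1` (`fibreTwo_add_eq_card_block_all`).
* §3 the floor **`μ(Q_{4n}, c) ≥ β − 1`** for odd `n` (`card_block_sub_one_mem_lowerBounds_odd`); the matching family (`μ = β − 1`, `n` odd) is seat b23ʼs
  dicyclic law `Census/DicyclicTwistLaw.lean` along a datum `Dic(ℤ/2 × ℤ/n)`; the even levels are gen 39/40ʼs `μ = φ₂ = β`.

## References
* [Pohlmann1968] H. Pohlmann, Algebraic cycles on abelian varieties of complex multiplication type, Ann. of Math. 88 (1968), Thm 1.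
* [Milne1999] J. S. Milne, Lefschetz motives and the Tate conjecture, Compositio Math. 117 (1999), Prop. 2.1, p. 54.
-/

namespace Summit.HodgeConjecture.CorCM.Census.QuaternionColumn

open Finset QuaternionGroup
open Summit.HodgeConjecture.CorCM.Prior.AllgGroup.RfwfAllgGroup
open Summit.HodgeConjecture.CorCM.Census.BlockParity
open Summit.HodgeConjecture.CorCM.Census.Coinvariant
open Summit.HodgeConjecture.CorCM.Census.CyclicCharacter

noncomputable section

variable {n : ℕ} [NeZero n]

/-! ## §1 The cyclic character `Q_{4n} → ℤ/4` for odd `n` -/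

/-- **The cyclic character of `Q_{4n}`, `n` odd**: an additive `w : Q_{4n} → ℤ/4` with `w (xa 0) = 1`, `w (c) ≠ 0`, all of whose odd elements are
roots of `c` (`w (a i) = 2·(i mod 2)`, `w (xa j) = 2·(j mod 2) + 1`). [folklore] -/
theorem exists_cyclicCharacter_of_odd (hodd : Odd n) :
    ∃ w : QuaternionGroup n → ZMod (2 ^ 2), (∀ P Q : QuaternionGroup n, w (P * Q) = w P + w Q) ∧ w (xa 0) = 1 ∧ w (c n) ≠ 0 ∧
      ∀ g : QuaternionGroup n, ¬ 2 ∣ (w g).val → c n ∈ Subgroup.zpowers g := by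
  obtain ⟨ε⟩ : Nonempty (ZMod (2 * n) →+* ZMod 2) := ⟨ZMod.castHom (dvd_mul_right 2 n) (ZMod 2)⟩
  have hεn : ε (n : ZMod (2 * n)) = 1 := by rw [map_natCast, ZMod.natCast_eq_one_iff_odd]; exact hodd
  have k1 : ∀ x y : ZMod 2, (2 * (((x + y).val : ℕ) : ZMod (2 ^ 2))) =
      2 * ((x.val : ℕ) : ZMod (2 ^ 2)) + 2 * ((y.val : ℕ) : ZMod (2 ^ 2)) := by decide
  have k2 : ∀ x y : ZMod 2, (2 * (((y - x).val : ℕ) : ZMod (2 ^ 2))) + 1 =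
      2 * ((x.val : ℕ) : ZMod (2 ^ 2)) + (2 * ((y.val : ℕ) : ZMod (2 ^ 2)) + 1) := by decide
  have k3 : ∀ x y : ZMod 2, (2 * (((x + y).val : ℕ) : ZMod (2 ^ 2))) + 1 =
      (2 * ((x.val : ℕ) : ZMod (2 ^ 2)) + 1) + 2 * ((y.val : ℕ) : ZMod (2 ^ 2)) := by decide
  have k4 : ∀ x y : ZMod 2, (2 * (((1 + y - x).val : ℕ) : ZMod (2 ^ 2))) =
      (2 * ((x.val : ℕ) : ZMod (2 ^ 2)) + 1) + (2 * ((y.val : ℕ) : ZMod (2 ^ 2)) + 1) := by decide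
  have k5 : ∀ x : ZMod 2, 2 ∣ ((2 : ZMod (2 ^ 2)) * ((x.val : ℕ) : ZMod (2 ^ 2))).val := by decide
  refine ⟨fun g => match g with
      | a i => 2 * (((ε i).val : ℕ) : ZMod (2 ^ 2))
      | xa j => 2 * (((ε j).val : ℕ) : ZMod (2 ^ 2)) + 1, ?_, ?_, ?_, ?_⟩
  · intro P Q
    cases P with
    | a i =>
      cases Q with
      | a j => simp only [a_mul_a, map_add, k1]
      | xa j => simp only [a_mul_xa, map_sub, k2]
    | xa i =>
      cases Q with
      | a j => simp only [xa_mul_a, map_add, k3]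
      | xa j => simp only [xa_mul_xa, map_sub, map_add, hεn, k4]
  · simp only [map_zero, ZMod.val_zero, Nat.cast_zero, mul_zero, zero_add]
  · show (2 * (((ε (n : ZMod (2 * n))).val : ℕ) : ZMod (2 ^ 2))) ≠ 0
    rw [hεn, ZMod.val_one]
    decide
  · intro g hg
    cases g with
    | a i => exact absurd (k5 (ε i)) hg
    | xa j => exact (c_mem_zpowers_iff_even_orderOf _).mpr (by rw [orderOf_xa]; exact ⟨2, rfl⟩)

/-! ## §2 The fibre law at odd level, and for the whole column -/

/-- **`φ₂(Q_{4n}, c) + 1 = β(Q_{4n}, c)` for every ODD `n`** (the cyclic-character fibre law with `d = 1`). [folklore] -/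
theorem fibreTwo_add_one_eq_card_block_odd (hodd : Odd n) : fibreTwo (c n) c_mul_c + 1 = Fintype.card (Block (c n)) := by
  obtain ⟨w, hw, h1, hwc, hroots⟩ := exists_cyclicCharacter_of_odd hodd
  exact CyclicCharacter.fibreTwo_add_one_eq_card_block hw (le_refl 2) ⟨xa 0, h1⟩ c_mul_c c_comm hwc hroots

/-- **`φ₂(Q_{4n}, c) = β(Q_{4n}, c) − 1` for every odd `n`.** [folklore] -/
theorem fibreTwo_eq_card_block_sub_one_odd (hodd : Odd n) : fibreTwo (c n) c_mul_c = Fintype.card (Block (c n)) - 1 := by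
  have h := fibreTwo_add_one_eq_card_block_odd hodd
  omega

/-- **THE FIBRE LAW OF THE WHOLE QUATERNION COLUMN: `φ₂(Q_{4n}, c) + [n odd] = β(Q_{4n}, c)`** for every `n ≥ 1` (even: gen 40ʼs
`fibreTwo_eq_card_block`; odd: §2). [folklore] -/
theorem fibreTwo_add_eq_card_block_all : fibreTwo (c n) c_mul_c + (if Even n then 0 else 1) = Fintype.card (Block (c n)) := by
  split_ifs with h
  · rw [add_zero]
    exact fibreTwo_eq_card_block h
  · exact fibreTwo_add_one_eq_card_block_odd (Nat.not_even_iff_odd.mp h)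

/-! ## §3 The floor at odd level -/

/-- **`μ(Q_{4n}, c) ≥ β − 1` for odd `n`**: every family of faces whose base changes generate the Hodge lattice modulo pairs has at least `β − 1`
members (`β − 1` is a lower bound of the face census). [folklore] -/
theorem card_block_sub_one_mem_lowerBounds_odd (hodd : Odd n) :
    Fintype.card (Block (c n)) - 1 ∈ lowerBounds {m : ℕ | ∃ S : Finset (CMF (QuaternionGroup n) (c n) →₀ ℤ),
      (↑S ⊆ gfaceSet (QuaternionGroup n) (c n) c_mul_c) ∧ S.card = m ∧
      hodgeSpan (c n) c_mul_c ≤ Submodule.span ℤ (pairSet (c n)) ⊔ Submodule.span ℤ (translates (c n) S)} := by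
  rintro m ⟨S, hS, rfl, hgen⟩
  have hfloor := fibreTwo_le_card_of_faces (c n) c_mul_c c_comm S hS fun y hy => hgen (gfaceSet_subset_hodgeSpan (c n) c_mul_c hy)
  have hlaw := fibreTwo_add_one_eq_card_block_odd hodd
  omega

/-- **For every family of integer HODGE vectors** of `(Q_{4n}, c)`, `n` odd, generating the faces modulo pairs: `β ≤ |S| + 1`. [folklore] -/
theorem card_block_le_card_add_one_odd (hodd : Odd n) (S : Finset (CMF (QuaternionGroup n) (c n) →₀ ℤ))
    (P₀ : Submodule ℤ (CMF (QuaternionGroup n) (c n) →₀ ℤ)) (hP₀ : P₀ ≤ Submodule.span ℤ (pairSet (c n)))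
    (hS : (S : Set (CMF (QuaternionGroup n) (c n) →₀ ℤ)) ⊆ hodgeSpan (c n) c_mul_c)
    (hX : gfaceSet (QuaternionGroup n) (c n) c_mul_c ⊆ ↑(P₀ ⊔ Submodule.span ℤ (translates (c n) S))) :
    Fintype.card (Block (c n)) ≤ S.card + 1 := by
  have hfloor := fibreTwo_le_card (c n) c_mul_c c_comm S P₀ hP₀ hS hX
  have hlaw := fibreTwo_add_one_eq_card_block_odd hodd
  omega

end

end Summit.HodgeConjecture.CorCM.Census.QuaternionColumn
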